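import Mathlib
import HarnessLib
import Literature.MathematicalPhysics.QuantumFieldTheory.ConstructiveQFTWave0
import Summits.QuantumFields.GaugeBoot.LatticeWords
import Summits.Ventures.LatticeQCDFlow.Scaling.GaugeForestTrivial
import Summits.Ventures.LatticeQCDFlow.Scaling.GaugeCycleHolonomy

/-!
# LatticeQCDFlow / Scaling — gauge classes on a theta graph (a cycle plus an ear between two of its
# sites, e.g. two plaquettes sharing a link): the invariant is the JOINT conjugacy class of the two
# based loop holonomies

HONEST FRAMING: exact (Metropolis-corrected) sampling algorithms for lattice gauge theory;
figures of merit are autocorrelation/cost numbers at stated couplings and volumes; no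
continuum-physics claim.

Venture `LatticeQCDFlow` (cell pub-lqcd), topic `Scaling`, FANOUT row 30 (lean-1, GEN-16) — OUR WORK,
sequel of `Scaling/GaugeCycleHolonomy` (word holonomies are gauge covariant; the EAR LEMMA
`exists_gaugeTransform_ear`; on a simple cycle two configurations are gauge related iff their
holonomies are conjugate).  The companion `Scaling/GaugeCycleForests` treats cycles meeting at a
POINT (bouquets); here two cycles share a PATH — the generic lattice situation (two plaquettes with a
common link).  Configuration level, every group `G`, every `d`, `L`; conventions as in the parent
(visited sites `w.scanl Step.apply x`, traversed links `List.zipWith Step.edge (w.scanl Step.apply x) w`).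

* §1 `zipWith_edge_append` — the links of a concatenation `A ++ B` from `x` are the links of `A` from
  `x` followed by the links of `B` from the endpoint of `A`.
* §2 also: `exists_gaugeTransform_eq_on_cycle_path` — a cycle with one OPEN ear hanging from it (the
  retained structure just before the ear closes) carries only the cycle's invariant.
* §2 **`exists_gaugeTransform_eq_on_theta`**, **`gaugeRelated_on_theta_iff`** — THE THETA GRAPH.  A
  closed simple word `C = c :: p` from `y`, split as `C = A ++ B` at the site `z = end(A)`, and an EAR
  `E = e :: q` from `y` to `z` whose sites after `y` meet `C` only at `z`.  Two configurations are gauge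
  related on the links of `C` and of `E` iff ONE `k` conjugates BOTH based loop holonomies
  `hol(C)` and `hol(E ++ B)` (the second loop runs out along the ear and back along the cycle):
  the invariant of a theta graph is the joint conjugacy class of the pair, exactly as for a figure
  eight — the shared path `B` does not reduce it.  Proof: cycle lemma on `C` (a `γ₁` with
  `γ₁(y) = k`), covariance of `hol(B)` under `γ₁`, then the ear lemma started from `γ₁`: the joint
  condition is precisely the ear lemma's covariance identity `hol_E(U') = γ₁(y) · hol_E(U) · γ₁(z)⁻¹`.

READING (value-free, THEORY-2 §4 C5 / T2-AF, autoregressive context in link variables; measure level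
in the sequels over `Scaling/AutoregressiveGaugeRedundancy`): when the link closing a SECOND
plaquette adjacent to an already retained one is generated, the exact conditional reads the seven
retained links through the joint conjugacy class of two based holonomies, not through two separate
plaquette classes.  NOT CLAIMED: the general ear-decomposition induction (the ear lemma is the
general step; theta and bouquet are the assembled cases); anything at the measure level here; any
number of ours.  Nearest prints as in the parent (gauge orbits on a finite graph `= G^E/G^V`, based
holonomies modulo simultaneous conjugation: Giles 1981, Baez 1996 §2, Gambini–Pullin 1996 Ch. 1).
No definition is introduced; nothing is cited as a fact; no `sorry`.
-/

noncomputable section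

namespace Summit.Ventures.LatticeQCDFlow.Theory2.Autoregressive

open Function
open Literature.MathematicalPhysics.QuantumFieldTheory
open Summit.QuantumFields.GaugeBoot

variable {d L : ℕ} {G : Type*} [Group G]

/-! ## §1 Links of a concatenation -/

/-- The links traversed by `A ++ B` from `x`: those of `A` from `x`, then those of `B` from the
endpoint of `A`. [ours] -/
theorem zipWith_edge_append :
    ∀ (x : Site d L) (A B : Word d),
      List.zipWith Step.edge ((A ++ B).scanl Step.apply x) (A ++ B) =
        List.zipWith Step.edge (A.scanl Step.apply x) A ++
          List.zipWith Step.edge (B.scanl Step.apply (Word.endpoint x A)) B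
  | x, [], B => by
    simp only [List.nil_append, Word.endpoint_nil]
    cases B <;> simp [List.scanl_cons]
  | x, s :: A, B => by
    rw [List.cons_append, zipWith_edge_cons, zipWith_edge_cons, Word.endpoint_cons,
      zipWith_edge_append (s.apply x) A B, List.cons_append]

/-! ## §2 The theta graph: a cycle plus an ear between two of its sites -/

/-- **Joint conjugacy ⇒ gauge related on a theta graph.**  `C = c :: p` a closed simple word from
`y`, split as `c :: p = A ++ B` (`z := end(A)`, so `B` runs from `z` back to `y` along the cycle);
`E = e :: q` an ear from `y` to `z` whose sites after `y` meet the cycle only at `z`.  If ONE `k`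
conjugates both `hol(C)` and `hol(E ++ B)`, then some `γ` with `γ(y) = k` maps `U` to `U'` on every
link of `C` and of `E`. [ours] -/
theorem exists_gaugeTransform_eq_on_theta (U U' : GaugeConfig d L G) (y : Site d L) (c : Step d)
    (p : Word d) (hCclosed : Word.endpoint y (c :: p) = y)
    (hCnd : (p.scanl Step.apply (c.apply y)).Nodup) (A B : Word d) (hAB : c :: p = A ++ B)
    (e : Step d) (q : Word d) (hEend : Word.endpoint y (e :: q) = Word.endpoint y A)
    (hEnd : (q.scanl Step.apply (e.apply y)).Nodup)
    (hEoff : ∀ v ∈ q.scanl Step.apply (e.apply y),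
      v ∈ (c :: p).scanl Step.apply y → v = Word.endpoint y A)
    (k : G) (hkC : wordHolonomy U' y (c :: p) = k * wordHolonomy U y (c :: p) * k⁻¹)
    (hkD : wordHolonomy U' y ((e :: q) ++ B) = k * wordHolonomy U y ((e :: q) ++ B) * k⁻¹) :
    ∃ γ : Site d L → G, γ y = k ∧
      (∀ l ∈ List.zipWith Step.edge ((c :: p).scanl Step.apply y) (c :: p),
        gaugeTransform γ U l = U' l) ∧
      ∀ l ∈ List.zipWith Step.edge ((e :: q).scanl Step.apply y) (e :: q),
        gaugeTransform γ U l = U' l := by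
  set z := Word.endpoint y A with hz
  -- the cycle
  obtain ⟨γ₁, hγ₁y, -, hγ₁C⟩ := exists_gaugeTransform_eq_on_cycle U U' y c p hCclosed hCnd k hkC
  -- `B` runs from `z` back to `y` inside the cycle, so `hol_B(U') = γ₁(z) · hol_B(U) · k⁻¹`
  have hBend : Word.endpoint z B = y := by
    rw [hz, ← Word.endpoint_append, ← hAB]; exact hCclosed
  have hBedges : ∀ l ∈ List.zipWith Step.edge (B.scanl Step.apply z) B,
      gaugeTransform γ₁ U l = U' l := by
    intro l hl
    apply hγ₁C
    rw [hAB, zipWith_edge_append]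
    exact List.mem_append_right _ hl
  have hB : wordHolonomy U' z B = γ₁ z * wordHolonomy U z B * k⁻¹ := by
    rw [← wordHolonomy_congr_of_forall_mem z B hBedges, wordHolonomy_gaugeTransform, hBend, hγ₁y]
  -- the joint condition is the ear lemma's covariance identity for `E`
  have hEend' : Word.endpoint y (e :: q) = z := hEend
  have hE : wordHolonomy U' y (e :: q) =
      γ₁ y * wordHolonomy U y (e :: q) * (γ₁ (Word.endpoint y (e :: q)))⁻¹ := by
    rw [wordHolonomy_append, wordHolonomy_append, hEend', hB] at hkD
    rw [hEend', hγ₁y]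
    calc wordHolonomy U' y (e :: q)
        = wordHolonomy U' y (e :: q) * (γ₁ z * wordHolonomy U z B * k⁻¹) *
            (γ₁ z * wordHolonomy U z B * k⁻¹)⁻¹ := by group
      _ = k * (wordHolonomy U y (e :: q) * wordHolonomy U z B) * k⁻¹ *
            (γ₁ z * wordHolonomy U z B * k⁻¹)⁻¹ := by rw [hkD]
      _ = k * wordHolonomy U y (e :: q) * (γ₁ z)⁻¹ := by group
  have hy : y ∉ q.scanl Step.apply (e.apply y) ∨ y = Word.endpoint (e.apply y) q := by
    by_cases hyq : y ∈ q.scanl Step.apply (e.apply y)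
    · right
      have := hEoff y hyq (start_mem_scanl y _)
      rw [← hEend', Word.endpoint_cons] at this
      exact this
    · exact Or.inl hyq
  obtain ⟨γ, hoff, hγz, hγy, hγE⟩ := exists_gaugeTransform_ear γ₁ U U' y e q hEnd hy hE
  -- `γ = γ₁` on the sites of the cycle (the ear meets it only at `z`, where they agree)
  have hfix : ∀ v ∈ (c :: p).scanl Step.apply y, γ v = γ₁ v := by
    intro v hv
    by_cases hvq : v ∈ q.scanl Step.apply (e.apply y)
    · have hvz : v = z := hEoff v hvq hv
      rw [hvz, ← hEend']; exact hγz
    · exact hoff v hvq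
  refine ⟨γ, hγy.trans hγ₁y, fun l hl => ?_, hγE⟩
  obtain ⟨h1, h2⟩ := endpoints_mem_scanl_of_mem_zipWith y (c :: p) hl
  rw [gaugeTransform_congr_endpoints U (hfix _ h1) (hfix _ h2)]
  exact hγ₁C l hl

/-- **GAUGE CLASSES ON A THETA GRAPH = JOINT CONJUGACY CLASSES OF THE TWO BASED LOOP HOLONOMIES.**
With `C = c :: p = A ++ B` a closed simple word from `y` and `E = e :: q` an ear from `y` to
`z = end(A)` meeting the cycle only at `z`: two configurations are gauge related on the links of `C`
and `E` iff one `k` conjugates both `hol(C)` and `hol(E ++ B)`. [ours] -/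
theorem gaugeRelated_on_theta_iff (U U' : GaugeConfig d L G) (y : Site d L) (c : Step d)
    (p : Word d) (hCclosed : Word.endpoint y (c :: p) = y)
    (hCnd : (p.scanl Step.apply (c.apply y)).Nodup) (A B : Word d) (hAB : c :: p = A ++ B)
    (e : Step d) (q : Word d) (hEend : Word.endpoint y (e :: q) = Word.endpoint y A)
    (hEnd : (q.scanl Step.apply (e.apply y)).Nodup)
    (hEoff : ∀ v ∈ q.scanl Step.apply (e.apply y),
      v ∈ (c :: p).scanl Step.apply y → v = Word.endpoint y A) :
    (∃ γ : Site d L → G,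
        (∀ l ∈ List.zipWith Step.edge ((c :: p).scanl Step.apply y) (c :: p),
          gaugeTransform γ U l = U' l) ∧
        ∀ l ∈ List.zipWith Step.edge ((e :: q).scanl Step.apply y) (e :: q),
          gaugeTransform γ U l = U' l) ↔
      ∃ k : G, wordHolonomy U' y (c :: p) = k * wordHolonomy U y (c :: p) * k⁻¹ ∧
        wordHolonomy U' y ((e :: q) ++ B) = k * wordHolonomy U y ((e :: q) ++ B) * k⁻¹ := by
  constructor
  · rintro ⟨γ, hγC, hγE⟩
    refine ⟨γ y, wordHolonomy_eq_conj_of_eqOn hCclosed hγC, wordHolonomy_eq_conj_of_eqOn ?_ ?_⟩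
    · -- `E ++ B` is closed: `E` ends at `z`, `B` runs from `z` to `y`
      rw [Word.endpoint_append, hEend, ← Word.endpoint_append, ← hAB]; exact hCclosed
    · intro l hl
      rw [zipWith_edge_append, List.mem_append, hEend] at hl
      rcases hl with hl | hl
      · exact hγE l hl
      · apply hγC
        rw [hAB, zipWith_edge_append]
        exact List.mem_append_right _ hl
  · rintro ⟨k, hkC, hkD⟩
    obtain ⟨γ, -, hγC, hγE⟩ := exists_gaugeTransform_eq_on_theta U U' y c p hCclosed hCnd A B hAB
      e q hEend hEnd hEoff k hkC hkD
    exact ⟨γ, hγC, hγE⟩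

/-- **A cycle with one OPEN ear hanging from it** (the retained structure just before the ear is
closed): a closed simple word `c :: p` from `y` and a simple open path `q` from `y₁` ENDING on the
cycle and otherwise off it.  If `hol_C(U') = k · hol_C(U) · k⁻¹` then some `γ` with `γ(y) = k` maps
`U` to `U'` on the cycle AND on the path (transport along `q` keeping the cycle's `γ`, whose value
at the end of `q` is kept). [ours] -/
theorem exists_gaugeTransform_eq_on_cycle_path (U U' : GaugeConfig d L G) (y : Site d L)
    (c : Step d) (p : Word d) (hCclosed : Word.endpoint y (c :: p) = y)
    (hCnd : (p.scanl Step.apply (c.apply y)).Nodup) (q : Word d) (y₁ : Site d L)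
    (hqnd : (q.scanl Step.apply y₁).Nodup)
    (hqoff : ∀ v ∈ q.scanl Step.apply y₁, v ∈ (c :: p).scanl Step.apply y →
      v = Word.endpoint y₁ q)
    (k : G) (hkC : wordHolonomy U' y (c :: p) = k * wordHolonomy U y (c :: p) * k⁻¹) :
    ∃ γ : Site d L → G, γ y = k ∧
      (∀ l ∈ List.zipWith Step.edge ((c :: p).scanl Step.apply y) (c :: p),
        gaugeTransform γ U l = U' l) ∧
      ∀ l ∈ List.zipWith Step.edge (q.scanl Step.apply y₁) q, gaugeTransform γ U l = U' l := by
  obtain ⟨γ₁, hγ₁y, -, hγ₁C⟩ := exists_gaugeTransform_eq_on_cycle U U' y c p hCclosed hCnd k hkC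
  obtain ⟨γ, hoff, hend, hγq⟩ := exists_gaugeTransform_eq_on_path_keep γ₁ U U' q y₁ hqnd
  have hfix : ∀ v ∈ (c :: p).scanl Step.apply y, γ v = γ₁ v := by
    intro v hv
    by_cases hvq : v ∈ q.scanl Step.apply y₁
    · rw [hqoff v hvq hv]; exact hend
    · exact hoff v hvq
  refine ⟨γ, (hfix y (start_mem_scanl y _)).trans hγ₁y, fun l hl => ?_, hγq⟩
  obtain ⟨h1, h2⟩ := endpoints_mem_scanl_of_mem_zipWith y (c :: p) hl
  rw [gaugeTransform_congr_endpoints U (hfix _ h1) (hfix _ h2)]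
  exact hγ₁C l hl

/-! ## §3 Instance: two plaquettes sharing a link -/

/-- Site arithmetic for the two plaquettes `(x; i, j)` and `(x + e_i; i, j)` read from the shared
corner `y = x + e_i`. [ours] -/
theorem twoPlaquette_sites (x : Site d L) (i j : Fin d) :
    (x.shift i).shift j - Pi.single i 1 = x.shift j ∧ x.shift j - Pi.single j 1 = x ∧
      ((x.shift i).shift i).shift j - Pi.single i 1 = (x.shift i).shift j := by
  refine ⟨?_, ?_, ?_⟩ <;> · simp only [Site.shift]; abel

/-- The links of the first plaquette `(x; i, j)` read as the cycle `+e_j −e_i −e_j +e_i` from the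
corner `y = x + e_i`: `(x+e_i, j), (x+e_j, i), (x, j), (x, i)`. [ours] -/
theorem plaquette₁_zipWith_edge (x : Site d L) (i j : Fin d) :
    List.zipWith Step.edge (([Step.fwd j, Step.bwd i, Step.bwd j, Step.fwd i] : Word d).scanl
      Step.apply (x.shift i)) [Step.fwd j, Step.bwd i, Step.bwd j, Step.fwd i] =
      [(x.shift i, j), (x.shift j, i), (x, j), (x, i)] := by
  obtain ⟨h1, h2, -⟩ := twoPlaquette_sites x i j
  simp [List.scanl_cons, h1, h2]

/-- The links of the ear `+e_i +e_j −e_i` from `y = x + e_i` (three links of the second plaquette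
`(x + e_i; i, j)`): `(x+e_i, i), (x+2e_i, j), (x+e_i+e_j, i)`. [ours] -/
theorem plaquette₂_ear_zipWith_edge (x : Site d L) (i j : Fin d) :
    List.zipWith Step.edge (([Step.fwd i, Step.fwd j, Step.bwd i] : Word d).scanl Step.apply
      (x.shift i)) [Step.fwd i, Step.fwd j, Step.bwd i] =
      [(x.shift i, i), ((x.shift i).shift i, j), ((x.shift i).shift j, i)] := by
  obtain ⟨-, -, h3⟩ := twoPlaquette_sites x i j
  simp [List.scanl_cons, h3]

/-- The holonomy of the first plaquette read from the corner `y = x + e_i` is the plaquette holonomy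
re-based: `U(x,i)⁻¹ · hol_{(x;i,j)} · U(x,i)`. [ours] -/
theorem wordHolonomy_plaquette₁_rebased (U : GaugeConfig d L G) (x : Site d L) (i j : Fin d) :
    wordHolonomy U (x.shift i) [Step.fwd j, Step.bwd i, Step.bwd j, Step.fwd i] =
      (U (x, i))⁻¹ * plaquetteHolonomy U x i j * U (x, i) := by
  obtain ⟨h1, h2, -⟩ := twoPlaquette_sites x i j
  simp [stepHolonomy, Step.apply, plaquetteHolonomy, h1, h2, mul_assoc]

/-- The holonomy of the loop "ear, then back along the first plaquette" from `y = x + e_i` is the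
product of the second plaquette's holonomy (based at its own corner `y`) and the re-based first
one. [ours] -/
theorem wordHolonomy_plaquette₂_loop (U : GaugeConfig d L G) (x : Site d L) (i j : Fin d) :
    wordHolonomy U (x.shift i) ([Step.fwd i, Step.fwd j, Step.bwd i] ++
      [Step.bwd i, Step.bwd j, Step.fwd i]) =
      plaquetteHolonomy U (x.shift i) i j * ((U (x, i))⁻¹ * plaquetteHolonomy U x i j * U (x, i)) := by
  obtain ⟨h1, h2, h3⟩ := twoPlaquette_sites x i j
  simp [stepHolonomy, Step.apply, plaquetteHolonomy, h1, h2, h3, mul_assoc]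

/-- The sites of the two plaquettes are in general position for `L ≥ 3`, `i ≠ j`: the first
plaquette read from `y = x + e_i` is a simple cycle, the ear is simple, and the ear meets the first
plaquette only at its end `x + e_i + e_j`. [ours] -/
theorem twoPlaquette_general_position (hL : 3 ≤ L) (x : Site d L) {i j : Fin d} (hij : i ≠ j) :
    (([Step.bwd i, Step.bwd j, Step.fwd i] : Word d).scanl Step.apply ((x.shift i).shift j)).Nodup ∧
    (([Step.fwd j, Step.bwd i] : Word d).scanl Step.apply ((x.shift i).shift i)).Nodup ∧
    ∀ v ∈ ([Step.fwd j, Step.bwd i] : Word d).scanl Step.apply ((x.shift i).shift i),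
      v ∈ ([Step.fwd j, Step.bwd i, Step.bwd j, Step.fwd i] : Word d).scanl Step.apply (x.shift i) →
        v = (x.shift i).shift j := by
  haveI : Fact (1 < L) := ⟨by omega⟩
  have hji : j ≠ i := fun h => hij h.symm
  have h2 : (2 : ZMod L) ≠ 0 := by
    have : ((2 : ℕ) : ZMod L) ≠ 0 := by
      rw [Ne, ZMod.natCast_eq_zero_iff]
      exact fun h => by have := Nat.le_of_dvd (by norm_num) h; omega
    simpa using this
  obtain ⟨e1, e2, e3⟩ := twoPlaquette_sites x i j
  -- pairwise distinctness of the seven sites involved, coordinate by coordinate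
  have n1 : (x.shift i).shift j ≠ x.shift j := fun h => by
    have h' := congrFun h i; simp [Site.shift, hji] at h'
  have n2 : (x.shift i).shift j ≠ x := fun h => by
    have h' := congrFun h i; simp [Site.shift, hji] at h'
  have n3 : (x.shift i).shift j ≠ x.shift i := fun h => by
    have h' := congrFun h j; simp [Site.shift] at h'
  have n4 : x.shift j ≠ x := fun h => by
    have h' := congrFun h j; simp [Site.shift] at h'
  have n5 : x.shift j ≠ x.shift i := fun h => by
    have h' := congrFun h i; simp [Site.shift, hji] at h'
  have n6 : x ≠ x.shift i := fun h => by
    have h' := congrFun h i; simp [Site.shift] at h'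
  have n7 : (x.shift i).shift i ≠ ((x.shift i).shift i).shift j := fun h => by
    have h' := congrFun h j; simp [Site.shift] at h'
  have n8 : (x.shift i).shift i ≠ (x.shift i).shift j := fun h => by
    have h' := congrFun h i; simp [Site.shift, hji] at h'
  have n9 : ((x.shift i).shift i).shift j ≠ (x.shift i).shift j := fun h => by
    have h' := congrFun h i; simp [Site.shift, hji] at h'
  -- the ear's fresh sites `x + 2e_i`, `x + 2e_i + e_j` are off the first plaquette
  have m1 : (x.shift i).shift i ≠ x.shift i := fun h => by
    have h' := congrFun h i; simp [Site.shift] at h'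
  have m2 : (x.shift i).shift i ≠ x.shift j := fun h => by
    have h' := congrFun h i; simp [Site.shift, hji, add_assoc] at h'; exact h2 (by
      have := h'; linear_combination this)
  have m3 : (x.shift i).shift i ≠ x := fun h => by
    have h' := congrFun h i; simp [Site.shift, add_assoc] at h'; exact h2 (by
      have := h'; linear_combination this)
  have m4 : ((x.shift i).shift i).shift j ≠ x.shift i := fun h => by
    have h' := congrFun h j; simp [Site.shift, hij] at h'
  have m5 : ((x.shift i).shift i).shift j ≠ x.shift j := fun h => by
    have h' := congrFun h i; simp [Site.shift, hji, add_assoc] at h'; exact h2 (by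
      have := h'; linear_combination this)
  have m6 : ((x.shift i).shift i).shift j ≠ x := fun h => by
    have h' := congrFun h i; simp [Site.shift, hji, add_assoc] at h'; exact h2 (by
      have := h'; linear_combination this)
  refine ⟨?_, ?_, ?_⟩
  · simp [List.scanl_cons, e1, e2, n1, n2, n3, n4, n5, n6]
  · simp [List.scanl_cons, e3, n7, n8, n9]
  · intro v hv hv'
    simp only [List.scanl_cons, List.scanl_nil, Step.apply_fwd, Step.apply_bwd, e1, e2, e3,
      List.mem_cons, List.not_mem_nil, or_false] at hv hv'
    rcases hv with rfl | rfl | rfl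
    · rcases hv' with h | h | h | h | h
      · exact absurd h m1
      · exact absurd h n8
      · exact absurd h m2
      · exact absurd h m3
      · exact absurd h m1
    · rcases hv' with h | h | h | h | h
      · exact absurd h m4
      · exact absurd h n9
      · exact absurd h m5
      · exact absurd h m6
      · exact absurd h m4
    · rfl

/-- **TWO PLAQUETTES SHARING A LINK ARE CLASSIFIED BY THE JOINT CONJUGACY CLASS OF THE PAIR OF
HOLONOMIES AT A SHARED CORNER** (`L ≥ 3`, `i ≠ j`).  The plaquettes `(x; i, j)` and `(x + e_i; i, j)`
share the link `(x + e_i, j)`; read both holonomies from the shared corner `y = x + e_i`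
(`h₁ = U(x,i)⁻¹ · hol_{(x;i,j)} · U(x,i)`, `h₂ = hol_{(x+e_i;i,j)}`).  Two configurations are gauge
related on the seven links iff ONE `k` conjugates both `h₁` and `h₂`. [ours] -/
theorem gaugeRelated_on_two_plaquettes_iff (hL : 3 ≤ L) (U U' : GaugeConfig d L G) (x : Site d L)
    {i j : Fin d} (hij : i ≠ j) :
    (∃ γ : Site d L → G,
        (∀ l ∈ [(x.shift i, j), (x.shift j, i), (x, j), (x, i)], gaugeTransform γ U l = U' l) ∧
        ∀ l ∈ [(x.shift i, i), ((x.shift i).shift i, j), ((x.shift i).shift j, i)],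
          gaugeTransform γ U l = U' l) ↔
      ∃ k : G, (U' (x, i))⁻¹ * plaquetteHolonomy U' x i j * U' (x, i) =
          k * ((U (x, i))⁻¹ * plaquetteHolonomy U x i j * U (x, i)) * k⁻¹ ∧
        plaquetteHolonomy U' (x.shift i) i j = k * plaquetteHolonomy U (x.shift i) i j * k⁻¹ := by
  obtain ⟨hCnd, hEnd, hEoff⟩ := twoPlaquette_general_position hL x hij
  have hCclosed : Word.endpoint (x.shift i) (Step.fwd j :: [Step.bwd i, Step.bwd j, Step.fwd i]) =
      x.shift i := by
    simp only [Word.endpoint_cons, Word.endpoint_nil, Step.apply, Site.shift]; abel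
  have hEend : Word.endpoint (x.shift i) (Step.fwd i :: [Step.fwd j, Step.bwd i]) =
      Word.endpoint (x.shift i) [Step.fwd j] := by
    simp only [Word.endpoint_cons, Word.endpoint_nil, Step.apply, Site.shift]; abel
  have key := gaugeRelated_on_theta_iff U U' (x.shift i) (Step.fwd j)
    [Step.bwd i, Step.bwd j, Step.fwd i] hCclosed hCnd [Step.fwd j] [Step.bwd i, Step.bwd j, Step.fwd i]
    rfl (Step.fwd i) [Step.fwd j, Step.bwd i] hEend hEnd
    (fun v hv hv' => by
      have := hEoff v hv hv'
      simpa [Word.endpoint_cons, Step.apply] using this)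
  rw [plaquette₁_zipWith_edge, plaquette₂_ear_zipWith_edge] at key
  rw [key]
  simp only [List.cons_append, List.nil_append]
  rw [show ([Step.fwd i, Step.fwd j, Step.bwd i, Step.bwd i, Step.bwd j, Step.fwd i] : Word d) =
      [Step.fwd i, Step.fwd j, Step.bwd i] ++ [Step.bwd i, Step.bwd j, Step.fwd i] from rfl,
    wordHolonomy_plaquette₂_loop, wordHolonomy_plaquette₂_loop, wordHolonomy_plaquette₁_rebased,
    wordHolonomy_plaquette₁_rebased]
  constructor
  · rintro ⟨k, h₁, h₂⟩
    refine ⟨k, h₁, ?_⟩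
    -- `h₂ h₁' = k h₂ h₁ k⁻¹` and `h₁' = k h₁ k⁻¹` give `h₂' = k h₂ k⁻¹`
    have := calc plaquetteHolonomy U' (x.shift i) i j
        = plaquetteHolonomy U' (x.shift i) i j *
            ((U' (x, i))⁻¹ * plaquetteHolonomy U' x i j * U' (x, i)) *
            ((U' (x, i))⁻¹ * plaquetteHolonomy U' x i j * U' (x, i))⁻¹ := by group
      _ = k * (plaquetteHolonomy U (x.shift i) i j *
            ((U (x, i))⁻¹ * plaquetteHolonomy U x i j * U (x, i))) * k⁻¹ *
            (k * ((U (x, i))⁻¹ * plaquetteHolonomy U x i j * U (x, i)) * k⁻¹)⁻¹ := by rw [h₂, h₁]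
      _ = k * plaquetteHolonomy U (x.shift i) i j * k⁻¹ := by group
    exact this
  · rintro ⟨k, h₁, h₂⟩
    refine ⟨k, h₁, ?_⟩
    rw [h₂, h₁]; group

end Summit.Ventures.LatticeQCDFlow.Theory2.Autoregressive

end
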